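import Literature.NumberTheory.LFunctions.SoundMainLemma
import Literature.NumberTheory.LFunctions.SoundZeroWindowSums
import Literature.NumberTheory.LFunctions.SoundararajanTypicalBridge
import Literature.NumberTheory.LFunctions.TypicalOrdinatePointwise
import Mathlib.Analysis.PSeries
import HarnessLib

/-!
# Balazard–de Roton 2008, Props. 6–8 and Prop. 1 (Soundararajan's lower bounds for `log|ζ|`)

Topic `Literature/NumberTheory/LFunctions`. Everything here is PROVED. From Soundararajan's main
lemma (`SoundTest.BR_prop5`, BR Prop. 5) and the typicality conditions (i)–(iii) of
`Soundararajan.IsTypical` we derive M. Balazard, A. de Roton, *Notes de lecture de l'article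
"Partial sums of the Möbius function" de Kannan Soundararajan*, arXiv:0810.3587:

* Prop. 6 (elementary): here `Σ_{j<K} a/(a²+(jh)²) ≤ 1/a + 3/h` (`sum_lorentz_le`);
* Prop. 7: `log|ζ(σ+it)| ≥ −D V/δ` for `½ + V/log T ≤ σ ≤ 2` at a typical ordinate;
* Prop. 8: `log|ζ(σ+it)| ≥ log|ζ(σ₀+it)| − V log((σ₀−½)/(σ−½)) − 2(1+δ)V log log V − D V δ⁻²`
  for `½ < σ ≤ σ₀ = ½ + V/log T`;
* **Prop. 1** in the packaged shape `TypicalPointwise.Prop1With δ D T₀` consumed by the contour files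
  (`prop1With_of_RH`).

## References

* [BalazardDeRoton2008] M. Balazard, A. de Roton, arXiv:0810.3587, Props. 1, 6, 7, 8. [cite: BalazardDeRoton2008, Props. 1, 6–8]
* K. Soundararajan, Partial sums of the Möbius function, J. reine angew. Math. 631 (2009), Prop. 5.
-/

noncomputable section

open Complex Filter Set MeasureTheory Topology intervalIntegral
open scoped Real

namespace Literature.NumberTheory.LFunctions

namespace SoundTest

open SchoenfeldBound Soundararajan

/-- Short name for the subtype of non-trivial zeros. -/
local notation "𝒵" => ZetaZeros.riemannZetaNontrivialZeros

/-! ## Prop. 6: the Lorentzian sum -/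

/-- **Balazard–de Roton 2008, Prop. 6 (variant):** `Σ_{j<K} a/(a² + (jh)²) ≤ 1/a + 3/h` for
`a, h > 0`. [cite: BalazardDeRoton2008, Prop. 6] -/
theorem sum_lorentz_le {a h : ℝ} (ha : 0 < a) (hh : 0 < h) (K : ℕ) :
    ∑ j ∈ Finset.range K, a / (a ^ 2 + ((j : ℝ) * h) ^ 2) ≤ 1 / a + 3 / h := by
  set j₀ : ℕ := ⌈a / h⌉₊ with hj₀
  have hj₀1 : 1 ≤ j₀ := Nat.one_le_iff_ne_zero.2 (Nat.pos_iff_ne_zero.1 (Nat.ceil_pos.2 (by positivity)))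
  have hj₀ge : a / h ≤ j₀ := Nat.le_ceil _
  have hj₀lt : (j₀ : ℝ) < a / h + 1 := Nat.ceil_lt_add_one (by positivity)
  -- small `j`: each term `≤ 1/a`, at most `j₀` terms
  have h1 : ∑ j ∈ (Finset.range K).filter (fun j ↦ j < j₀), a / (a ^ 2 + ((j : ℝ) * h) ^ 2) ≤ j₀ * (1 / a) := by
    have hterm : ∀ j ∈ (Finset.range K).filter (fun j ↦ j < j₀), a / (a ^ 2 + ((j : ℝ) * h) ^ 2) ≤ 1 / a := by
      intro j _
      rw [div_le_div_iff₀ (by positivity) ha]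
      nlinarith [sq_nonneg ((j : ℝ) * h)]
    refine (Finset.sum_le_sum hterm).trans ?_
    rw [Finset.sum_const, nsmul_eq_mul]
    gcongr
    exact (Finset.card_le_card (fun j hj ↦ by
      rw [Finset.mem_filter] at hj; exact Finset.mem_range.2 hj.2)).trans_eq (Finset.card_range _)
  -- large `j`: compare with `Σ_{j ≥ j₀} 1/j² ≤ 2/j₀`
  have h2 : ∑ j ∈ (Finset.range K).filter (fun j ↦ ¬j < j₀), a / (a ^ 2 + ((j : ℝ) * h) ^ 2) ≤
      a / h ^ 2 * (2 / j₀) := by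
    have hsub : (Finset.range K).filter (fun j ↦ ¬j < j₀) ⊆ Finset.Ioo (j₀ - 1) K := by
      intro j hj
      rw [Finset.mem_filter, Finset.mem_range] at hj
      rw [Finset.mem_Ioo]; omega
    have hterm : ∀ j ∈ Finset.Ioo (j₀ - 1) K, a / (a ^ 2 + ((j : ℝ) * h) ^ 2) ≤ a / h ^ 2 * ((j : ℝ) ^ 2)⁻¹ := by
      intro j hj
      rw [Finset.mem_Ioo] at hj
      have hj1 : (1 : ℝ) ≤ j := by exact_mod_cast (by omega : 1 ≤ j)
      have hjh : 0 < ((j : ℝ) * h) ^ 2 := by positivity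
      calc a / (a ^ 2 + ((j : ℝ) * h) ^ 2) ≤ a / (((j : ℝ) * h) ^ 2) :=
            div_le_div_of_nonneg_left ha.le hjh (by nlinarith [sq_nonneg a])
        _ = a / h ^ 2 * ((j : ℝ) ^ 2)⁻¹ := by field_simp
    calc ∑ j ∈ (Finset.range K).filter (fun j ↦ ¬j < j₀), a / (a ^ 2 + ((j : ℝ) * h) ^ 2)
        ≤ ∑ j ∈ Finset.Ioo (j₀ - 1) K, a / (a ^ 2 + ((j : ℝ) * h) ^ 2) :=
          Finset.sum_le_sum_of_subset_of_nonneg hsub fun j _ _ ↦ by positivity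
      _ ≤ ∑ j ∈ Finset.Ioo (j₀ - 1) K, a / h ^ 2 * ((j : ℝ) ^ 2)⁻¹ := Finset.sum_le_sum hterm
      _ = a / h ^ 2 * ∑ j ∈ Finset.Ioo (j₀ - 1) K, ((j : ℝ) ^ 2)⁻¹ := by rw [Finset.mul_sum]
      _ ≤ a / h ^ 2 * (2 / ((j₀ - 1 : ℕ) + 1)) := by
          gcongr; exact sum_Ioo_inv_sq_le (j₀ - 1) K
      _ = a / h ^ 2 * (2 / j₀) := by
          congr 2; rw [Nat.cast_sub hj₀1]; push_cast; ring
  -- combine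
  have h3 : (j₀ : ℝ) * (1 / a) ≤ 1 / h + 1 / a := by
    rw [mul_one_div, div_le_iff₀ ha]
    have : (a / h + 1) * a = 1 / h * a ^ 2 / 1 + a := by field_simp
    nlinarith [hj₀lt, mul_pos ha hh, show (1 / h + 1 / a) * a = a / h + 1 by field_simp]
  have h4 : a / h ^ 2 * (2 / j₀) ≤ 2 / h := by
    have hj₀pos : (0 : ℝ) < j₀ := by exact_mod_cast hj₀1
    rw [div_mul_div_comm, div_le_div_iff₀ (by positivity) hh]
    have := mul_le_mul_of_nonneg_left hj₀ge hh.le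
    rw [mul_div_cancel₀ _ hh.ne'] at this
    nlinarith [this]
  calc ∑ j ∈ Finset.range K, a / (a ^ 2 + ((j : ℝ) * h) ^ 2)
      = ∑ j ∈ (Finset.range K).filter (fun j ↦ j < j₀), a / (a ^ 2 + ((j : ℝ) * h) ^ 2) +
          ∑ j ∈ (Finset.range K).filter (fun j ↦ ¬j < j₀), a / (a ^ 2 + ((j : ℝ) * h) ^ 2) :=
        (Finset.sum_filter_add_sum_filter_not _ _ _).symm
    _ ≤ j₀ * (1 / a) + a / h ^ 2 * (2 / j₀) := add_le_add h1 h2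
    _ ≤ (1 / h + 1 / a) + 2 / h := add_le_add h3 h4
    _ = 1 / a + 3 / h := by ring

/-! ## The Dirichlet polynomial: `Re typicalSum = primeQ/log x` -/

/-- **`Re Σ_{n≤x} Λ(n) log(x/n)/(n^{σ+it} log n log x) = Q_{x,t}(σ)/log x`** (`x ≥ 1`). [folklore] -/
theorem re_typicalSum {x : ℝ} (hx : 1 ≤ x) (σ t : ℝ) : (typicalSum x σ t).re = primeQ x t σ / Real.log x := by
  unfold typicalSum primeQ
  rw [Complex.re_sum, Finset.sum_div]
  refine Finset.sum_congr rfl fun n hn ↦ ?_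
  rw [Finset.mem_Icc] at hn
  have hn0 : (0 : ℝ) < n := by exact_mod_cast hn.1
  have hcpow : ((n : ℂ) ^ (-((σ : ℂ) + t * I))).re = Real.exp (-σ * Real.log n) * Real.cos (t * Real.log n) := by
    rw [Complex.cpow_def_of_ne_zero (by exact_mod_cast hn0.ne'), ← Complex.ofReal_natCast,
      ← Complex.ofReal_log hn0.le, Complex.exp_re]
    simp only [Complex.mul_re, Complex.ofReal_re, Complex.ofReal_im, Complex.neg_re, Complex.add_re,
      Complex.mul_im, Complex.I_re, Complex.I_im, Complex.neg_im, Complex.add_im, mul_zero, mul_one,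
      zero_mul, sub_zero, add_zero, zero_add]
    rw [mul_neg, mul_neg, Real.cos_neg]
    ring_nf
  rw [Complex.re_ofReal_mul, hcpow, Real.log_div (by linarith) hn0.ne']
  rcases eq_or_ne (Real.log x) 0 with h0 | h0
  · simp [h0]
  · field_simp

/-- Condition (i) at a typical ordinate in real form: `|Q_{x,t}(σ)|/log x ≤ 2V` (`x = T^{1/V} ≥ 1`). [cite: BalazardDeRoton2008, §1 (i)] -/
theorem abs_primeQ_div_le_of_isTypical {δ T V t σ : ℝ} (h : IsTypical δ T V t) (hσ : 1 / 2 ≤ σ)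
    (hx : 1 ≤ T ^ (1 / V)) : |primeQ (T ^ (1 / V)) t σ / Real.log (T ^ (1 / V))| ≤ 2 * V := by
  rw [← re_typicalSum hx]
  exact (Complex.abs_re_le_norm _).trans (h.sum_le hσ)

/-! ## Prop. 7: `F(σ+it) ≪ δ⁻¹ log T` at a typical ordinate, hence `log|ζ| ≥ −D V/δ` -/

/-- **`F(σ+it)` through windows** (RH, `½ < σ ≤ 2`): if every window `]u, u+h]` inside
`[t − Kh, t + Kh]` (`Kh ≥ ½`, `t − Kh ≥ 0`) carries at most `B` zeros, then
`F(σ+it) ≤ 2B(1/(σ−½) + 3/h) + 8 Σ_ρ m(ρ)/(1+(t−γ)²)`. [cite: BalazardDeRoton2008, Prop. 7 (proof)] -/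
theorem reZeroSideSum_le_windows (hRH : RiemannHypothesis) {σ t h B : ℝ} (hσ : 1 / 2 < σ) (hσ2 : σ ≤ 2)
    (hh : 0 < h) (hB0 : 0 ≤ B) {K : ℕ} (hK : 1 / 2 ≤ K * h) (hKt : 0 ≤ t - K * h)
    (hwin : ∀ u : ℝ, t - K * h ≤ u → u + h ≤ t + K * h → (zetaZeroCount (u + h) : ℝ) - zetaZeroCount u ≤ B) :
    reZeroSideSum ((σ : ℂ) + t * I) ≤
      2 * B * (1 / (σ - 1 / 2) + 3 / h) + 8 * ∑' ρ : 𝒵, (riemannZetaZeroOrder (ρ : ℂ) : ℝ) / (1 + (t - (ρ : ℂ).im) ^ 2) := by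
  set a : ℝ := σ - 1 / 2 with ha
  have ha0 : 0 < a := by rw [ha]; linarith
  have ha3 : a ≤ 3 / 2 := by rw [ha]; linarith
  set w : ℝ → ℝ := fun y ↦ a / (a ^ 2 + (y - t) ^ 2) with hw
  have hF : reZeroSideSum ((σ : ℂ) + t * I) = ∑' ρ : 𝒵, (riemannZetaZeroOrder (ρ : ℂ) : ℝ) * w (ρ : ℂ).im := by
    rw [reZeroSideSum_def]
    refine tsum_congr fun ρ ↦ ?_
    rw [re_inv_sub_zero_of_RH hRH]
  have hsum : Summable fun ρ : 𝒵 ↦ (riemannZetaZeroOrder (ρ : ℂ) : ℝ) * w (ρ : ℂ).im := by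
    refine ((summable_zeroOrder_div_dist_sq hσ t).mul_left a).congr fun ρ ↦ ?_
    simp only [hw]; ring
  have hw0 : ∀ y, 0 ≤ w y := fun y ↦ by positivity
  set Wj : ℕ → ℝ := fun j ↦ a / (a ^ 2 + ((j : ℝ) * h) ^ 2) with hWj
  have hWj0 : ∀ j, 0 ≤ Wj j := fun j ↦ by positivity
  have hW : ∀ (j : ℕ) (y : ℝ), (j : ℝ) * h ≤ |t - y| → w y ≤ Wj j := by
    intro j y hy
    simp only [hw, hWj]
    refine div_le_div_of_nonneg_left ha0.le (by positivity) ?_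
    have : ((j : ℝ) * h) ^ 2 ≤ (y - t) ^ 2 := by
      rw [← sq_abs (y - t), abs_sub_comm]; exact pow_le_pow_left₀ (by positivity) hy 2
    linarith
  have htail : ∀ y : ℝ, (K : ℝ) * h ≤ |t - y| → w y ≤ 8 / (1 + (t - y) ^ 2) := by
    intro y hy
    simp only [hw]
    have hd : 1 / 4 ≤ (t - y) ^ 2 := by
      have h1 : 1 / 2 ≤ |t - y| := hK.trans hy
      nlinarith [abs_nonneg (t - y), sq_abs (t - y)]
    have e : (y - t) ^ 2 = (t - y) ^ 2 := by ring
    rw [e, div_le_div_iff₀ (by positivity) (by positivity)]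
    nlinarith [sq_nonneg a]
  have hmain := tsum_zeroOrder_mul_le_windows_add_tail hh hw0 hWj0 hW hKt hwin (by norm_num : (0 : ℝ) ≤ 8) htail hsum
  rw [hF]
  refine hmain.trans ?_
  have hsum_le := sum_lorentz_le ha0 hh K
  have := mul_le_mul_of_nonneg_left hsum_le (by positivity : 0 ≤ 2 * B)
  linarith

/-- Window counts from condition (ii) of a typical ordinate: with `h = 2πδV/log T` and `Kh ≤ 1`,
every window `]u, u+h]` inside `[t − Kh, t + Kh]` has at most `(1+δ)V` zeros. [cite: BalazardDeRoton2008, §1 (ii)] -/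
theorem window_count_of_isTypical {δ T V t : ℝ} (ht : IsTypical δ T V t) {K : ℕ}
    (hK1 : (K : ℝ) * (2 * π * δ * V / Real.log T) ≤ 1) :
    ∀ u : ℝ, t - K * (2 * π * δ * V / Real.log T) ≤ u →
      u + 2 * π * δ * V / Real.log T ≤ t + K * (2 * π * δ * V / Real.log T) →
      (zetaZeroCount (u + 2 * π * δ * V / Real.log T) : ℝ) - zetaZeroCount u ≤ (1 + δ) * V := by
  intro u hu1 hu2
  have h2 := ht.2.2.2.1 (u + Real.pi * δ * V / Real.log T) (by linarith) (by
    have : u + Real.pi * δ * V / Real.log T + Real.pi * δ * V / Real.log T = u + 2 * π * δ * V / Real.log T := by ring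
    rw [this]; linarith)
  have e1 : u + Real.pi * δ * V / Real.log T + Real.pi * δ * V / Real.log T = u + 2 * π * δ * V / Real.log T := by ring
  have e2 : u + Real.pi * δ * V / Real.log T - Real.pi * δ * V / Real.log T = u := by ring
  rwa [e1, e2] at h2

/-- A number of windows `K` with `½ ≤ Kh ≤ 1` (`0 < h ≤ ½`). [folklore] -/
theorem exists_window_number {h : ℝ} (hh : 0 < h) (hh2 : h ≤ 1 / 2) :
    ∃ K : ℕ, 1 / 2 ≤ (K : ℝ) * h ∧ (K : ℝ) * h ≤ 1 := by
  refine ⟨⌈1 / (2 * h)⌉₊, ?_, ?_⟩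
  · have h1 : 1 / (2 * h) ≤ (⌈1 / (2 * h)⌉₊ : ℝ) := Nat.le_ceil _
    have := mul_le_mul_of_nonneg_right h1 hh.le
    rwa [show 1 / (2 * h) * h = 1 / 2 by field_simp] at this
  · have h1 : (⌈1 / (2 * h)⌉₊ : ℝ) < 1 / (2 * h) + 1 := Nat.ceil_lt_add_one (by positivity)
    have := mul_le_mul_of_nonneg_right h1.le hh.le
    rw [show (1 / (2 * h) + 1) * h = 1 / 2 + h by field_simp] at this
    linarith

set_option maxHeartbeats 800000 in
/-- **Balazard–de Roton 2008, Prop. 7, under RH:** there are absolute `D, T₀` such that for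
`T ≥ T₀`, `(log log T)² ≤ V ≤ log T/log log T`, `0 < δ ≤ 1`, a `V`-typical `t` and
`½ + V/log T ≤ σ ≤ 2`: `log|ζ(σ+it)| ≥ −D V/δ`. [cite: BalazardDeRoton2008, Prop. 7] -/
theorem BR_prop7 (hRH : RiemannHypothesis) : ∃ D T₀ : ℝ, 0 ≤ D ∧ ∀ T : ℝ, T₀ ≤ T → ∀ V : ℝ,
    Real.log (Real.log T) ^ 2 ≤ V → V ≤ Real.log T / Real.log (Real.log T) →
    ∀ δ : ℝ, 0 < δ → δ ≤ 1 → ∀ t : ℝ, IsTypical δ T V t →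
    ∀ σ : ℝ, 1 / 2 + V / Real.log T ≤ σ → σ ≤ 2 → -(D * V * δ⁻¹) ≤ Real.log ‖riemannZeta (σ + t * I)‖ := by
  obtain ⟨C₅, hC₅⟩ := BR_prop5 hRH
  obtain ⟨A, hA0, hA⟩ := exists_tsum_zeroOrder_div_one_add_sq_le
  refine ⟨14 + 32 * A + |C₅|, Real.exp (Real.exp 17), by positivity, fun T hT V hVl hVu δ hδ0 hδ1 t ht σ hσ1 hσ2 ↦ ?_⟩
  -- sizes
  have hee : 0 < Real.exp (Real.exp 17) := Real.exp_pos _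
  have hT0 : 0 < T := hee.trans_le hT
  have hL1 : Real.exp 17 ≤ Real.log T := by
    rw [← Real.log_exp (Real.exp 17)]; exact Real.log_le_log hee hT
  have h14 : (18 : ℝ) ≤ Real.exp 17 := by have := Real.add_one_le_exp (17 : ℝ); linarith
  have hlogT : 18 ≤ Real.log T := h14.trans hL1
  have hlogT0 : 0 < Real.log T := by linarith
  have hL2 : 17 ≤ Real.log (Real.log T) := by
    rw [← Real.log_exp 17]; exact Real.log_le_log (Real.exp_pos _) hL1
  have hL20 : 0 < Real.log (Real.log T) := by linarith
  have hV196 : 196 ≤ V := le_trans (by nlinarith) hVl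
  have hV1 : 1 ≤ V := by linarith
  have hVlog : V ≤ Real.log T := hVu.trans (div_le_self hlogT0.le (by linarith))
  obtain ⟨hTt, ht2T⟩ := ht.size
  have ht8 : 8 ≤ t := by
    have : Real.log T ≤ T := (Real.log_le_sub_one_of_pos hT0).trans (by linarith)
    linarith
  -- `x = T^{1/V}`, `L = log x = log T / V`
  set x : ℝ := T ^ (1 / V) with hx
  have hx0 : 0 < x := Real.rpow_pos_of_pos hT0 _
  have hLx : Real.log x = Real.log T / V := by
    rw [hx, Real.log_rpow hT0]; ring
  set L : ℝ := Real.log T / V with hL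
  have hL0 : 0 < L := by positivity
  have hLge : Real.log (Real.log T) ≤ L := by
    rw [hL, le_div_iff₀ (by linarith)]
    rw [le_div_iff₀ hL20] at hVu; linarith
  have hx3 : 3 ≤ x := by
    have : Real.log 3 ≤ Real.log x := by
      rw [hLx]
      have h3 : Real.log 3 ≤ 2 := by
        have := Real.log_le_sub_one_of_pos (show (0:ℝ) < 3 by norm_num); linarith
      linarith
    exact (Real.log_le_log_iff (by norm_num) hx0).1 this
  have hxT : x ≤ T := by
    have : Real.log x ≤ Real.log T := by
      rw [hLx, div_le_iff₀ (by linarith)]; nlinarith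
    exact (Real.log_le_log_iff hx0 hT0).1 this
  have hxt : x ≤ t := hxT.trans hTt
  have hσ : 1 / 2 < σ := by
    have : 0 < V / Real.log T := by positivity
    linarith
  -- Prop. 5
  have h5 := hC₅ σ t x hσ hσ2 hx3 hxt ht8
  rw [hLx] at h5
  -- condition (i)
  have hQ : |primeQ x t σ / L| ≤ 2 * V := by
    have := abs_primeQ_div_le_of_isTypical ht hσ.le (by rw [← hx]; linarith)
    rwa [← hx, hLx] at this
  -- `x^{½−σ}/((σ−½)L) ≤ 1`
  have hr : Real.exp ((1 / 2 - σ) * L) / ((σ - 1 / 2) * L) ≤ 1 := by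
    have hy : 1 ≤ (σ - 1 / 2) * L := by
      have : V / Real.log T * L = 1 := by rw [hL]; field_simp
      nlinarith [mul_le_mul_of_nonneg_right hσ1 hL0.le]
    rw [div_le_one (by linarith)]
    have : Real.exp ((1 / 2 - σ) * L) ≤ 1 := Real.exp_le_one_iff.2 (by nlinarith)
    linarith
  have hF0 : 0 ≤ reZeroSideSum ((σ : ℂ) + t * I) := reZeroSideSum_nonneg_of_RH hRH hσ t
  -- the window bound for `F`
  set hw : ℝ := 2 * π * δ * V / Real.log T with hhw
  have hπ3 := Real.pi_gt_three
  have hπ4 := Real.pi_lt_four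
  have hhw0 : 0 < hw := by positivity
  have hhw_le : hw ≤ 1 / 2 := by
    -- `hw ≤ 8V/log T ≤ 8/log log T ≤ 1/2`
    rw [hhw, div_le_iff₀ hlogT0]
    have hpd : π * δ ≤ 4 := by nlinarith
    have h1 : 2 * π * δ * V ≤ 8 * V := by nlinarith [mul_le_mul_of_nonneg_right hpd (by linarith : (0 : ℝ) ≤ V)]
    have h2 : V * Real.log (Real.log T) ≤ Real.log T := by rwa [le_div_iff₀ hL20] at hVu
    have h3 : 17 * V ≤ Real.log T := le_trans (by nlinarith) h2
    linarith
  obtain ⟨K, hKge, hKle⟩ := exists_window_number hhw0 hhw_le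
  have hKt : 0 ≤ t - K * hw := by
    have : (1 : ℝ) ≤ T := by
      have := Real.add_one_le_exp (Real.exp 17); linarith [Real.exp_pos (17:ℝ)]
    linarith
  have hwin := window_count_of_isTypical ht (K := K) hKle
  have hB0 : 0 ≤ (1 + δ) * V := by positivity
  have hFle := reZeroSideSum_le_windows hRH hσ hσ2 hhw0 hB0 hKge hKt hwin
  have hDt := hA t
  -- numerics: `F ≤ (6 + 16A) log T / δ`
  have hlogt : Real.log (|t| + 2) ≤ 2 * Real.log T := by
    rw [abs_of_pos (by linarith)]
    have h1 : Real.log (t + 2) ≤ Real.log (T ^ 2) := by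
      refine Real.log_le_log (by linarith) ?_
      nlinarith
    rw [Real.log_pow] at h1; push_cast at h1; linarith
  have hinvδ : 1 ≤ δ⁻¹ := one_le_inv_iff₀.2 ⟨hδ0, hδ1⟩
  have hFbound : reZeroSideSum ((σ : ℂ) + t * I) ≤ (6 + 16 * A) * Real.log T * δ⁻¹ := by
    set ℓT : ℝ := Real.log T with hℓT
    have hδℓ : δ * ℓT ≤ ℓT := by nlinarith
    -- term 1: `2(1+δ)V/(σ−½) ≤ 4 log T`
    have ha : 1 / (σ - 1 / 2) ≤ ℓT / V := by
      rw [div_le_div_iff₀ (by linarith) (by linarith), one_mul]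
      have := mul_le_mul_of_nonneg_right hσ1 hlogT0.le
      have e : (1 / 2 + V / ℓT) * ℓT = ℓT / 2 + V := by field_simp
      rw [e] at this
      nlinarith
    have t1 : 2 * ((1 + δ) * V) * (1 / (σ - 1 / 2)) ≤ 4 * ℓT := by
      have h1 := mul_le_mul_of_nonneg_left ha (by positivity : 0 ≤ 2 * ((1 + δ) * V))
      have e : 2 * ((1 + δ) * V) * (ℓT / V) = 2 * (1 + δ) * ℓT := by field_simp
      rw [e] at h1
      nlinarith [h1, hδℓ]
    -- term 2: `6(1+δ)V/hw = 3(1+δ) log T/(πδ) ≤ 2 log T/δ`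
    have t2 : 2 * ((1 + δ) * V) * (3 / hw) ≤ 2 * ℓT * δ⁻¹ := by
      have e : 2 * ((1 + δ) * V) * (3 / hw) = (3 * (1 + δ) / π) * (ℓT * δ⁻¹) := by
        rw [hhw]; field_simp
      rw [e]
      have hcoef : 3 * (1 + δ) / π ≤ 2 := by
        rw [div_le_iff₀ (by linarith)]; nlinarith
      have hpos : 0 ≤ ℓT * δ⁻¹ := by positivity
      nlinarith [hcoef, hpos]
    -- tail: `8 D(t) ≤ 16 A log T`
    have t3 : 8 * ∑' ρ : 𝒵, (riemannZetaZeroOrder (ρ : ℂ) : ℝ) / (1 + (t - (ρ : ℂ).im) ^ 2) ≤ 16 * A * ℓT := by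
      have := hDt.trans (mul_le_mul_of_nonneg_left hlogt hA0.le)
      linarith
    -- combine, using `log T ≤ log T · δ⁻¹`
    have t4 : ℓT ≤ ℓT * δ⁻¹ := le_mul_of_one_le_right hlogT0.le hinvδ
    have e : 2 * ((1 + δ) * V) * (1 / (σ - 1 / 2) + 3 / hw) =
        2 * ((1 + δ) * V) * (1 / (σ - 1 / 2)) + 2 * ((1 + δ) * V) * (3 / hw) := by ring
    rw [e] at hFle
    have hA16 : 16 * A * ℓT ≤ 16 * A * (ℓT * δ⁻¹) := mul_le_mul_of_nonneg_left t4 (by positivity)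
    have : (6 + 16 * A) * ℓT * δ⁻¹ = 4 * (ℓT * δ⁻¹) + 2 * ℓT * δ⁻¹ + 16 * A * (ℓT * δ⁻¹) := by ring
    rw [this]
    linarith [hFle, t1, t2, t3, t4, hA16]
  -- Prop. 5 ⇒ `log|ζ| ≥ −2V − 2F/L − C₅`
  have hmain : -(2 * V) - 2 * ((6 + 16 * A) * V * δ⁻¹) - C₅ ≤ Real.log ‖riemannZeta ((σ : ℂ) + t * I)‖ := by
    have hq := (abs_le.1 hQ).1
    -- `(1 + r) F / L ≤ 2 F / L = 2 F V/log T ≤ 2 (6+16A) V/δ`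
    have h1 : (1 + Real.exp ((1 / 2 - σ) * L) / ((σ - 1 / 2) * L)) * reZeroSideSum ((σ : ℂ) + t * I) / L ≤
        2 * ((6 + 16 * A) * V * δ⁻¹) := by
      have hr0 : 0 ≤ Real.exp ((1 / 2 - σ) * L) / ((σ - 1 / 2) * L) := by positivity
      calc (1 + Real.exp ((1 / 2 - σ) * L) / ((σ - 1 / 2) * L)) * reZeroSideSum ((σ : ℂ) + t * I) / L
          ≤ 2 * reZeroSideSum ((σ : ℂ) + t * I) / L := by
            gcongr; linarith
        _ ≤ 2 * ((6 + 16 * A) * Real.log T * δ⁻¹) / L := by gcongr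
        _ = 2 * ((6 + 16 * A) * V * δ⁻¹) := by rw [hL]; field_simp
    linarith [h5, h1, hq]
  -- absorb constants: `V ≥ 1`, `δ⁻¹ ≥ 1`
  have hVδ : V ≤ V * δ⁻¹ := le_mul_of_one_le_right (by linarith) hinvδ
  have hVδ1 : 1 ≤ V * δ⁻¹ := le_trans hV1 hVδ
  have hC5 : C₅ ≤ |C₅| * (V * δ⁻¹) := (le_abs_self C₅).trans (le_mul_of_one_le_right (abs_nonneg _) hVδ1)
  have hAV : 0 ≤ A * (V * δ⁻¹) := by positivity
  have e : (14 + 32 * A + |C₅|) * V * δ⁻¹ = 14 * (V * δ⁻¹) + 32 * (A * (V * δ⁻¹)) + |C₅| * (V * δ⁻¹) := by ring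
  have e2 : (6 + 16 * A) * V * δ⁻¹ = 6 * (V * δ⁻¹) + 16 * (A * (V * δ⁻¹)) := by ring
  rw [e2] at hmain
  rw [e]
  linarith [hmain, hVδ, hVδ1, hC5, hAV]

/-! ## Prop. 8: `log|ζ(σ₀+it)| − log|ζ(σ+it)|` for `½ < σ ≤ σ₀ = ½ + V/log T` -/

/-- `∫_σ^{σ₁} Re ζ'/ζ(u+it) du = log|ζ(σ₁+it)| − log|ζ(σ+it)|` (RH, `½ < σ ≤ σ₁`, `t ≠ 0`). [folklore] -/
theorem integral_re_logDeriv_zeta' (hRH : RiemannHypothesis) {σ σ₁ t : ℝ} (hσ : 1 / 2 < σ) (hσ1 : σ ≤ σ₁)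
    (ht : t ≠ 0) :
    ∫ u in σ..σ₁, (deriv riemannZeta ((u : ℂ) + t * I) / riemannZeta ((u : ℂ) + t * I)).re =
      Real.log ‖riemannZeta ((σ₁ : ℂ) + t * I)‖ - Real.log ‖riemannZeta ((σ : ℂ) + t * I)‖ := by
  have hg : ∀ u ∈ Icc σ σ₁, AnalyticAt ℂ riemannZeta ((u : ℂ) + t * I) := fun u _ ↦ analyticAt_zeta_line ht
  have h0 : ∀ u ∈ Icc σ σ₁, riemannZeta ((u : ℂ) + t * I) ≠ 0 := fun u hu ↦
    zeta_line_ne_zero hRH (by linarith [hu.1]) ht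
  have h := Literature.Analysis.Complex.re_integral_logDeriv_horizontal t hσ1 hg h0
  have hint : IntervalIntegrable (fun u : ℝ ↦ deriv riemannZeta ((u : ℂ) + t * I) / riemannZeta ((u : ℂ) + t * I))
      volume σ σ₁ := by
    refine ContinuousOn.intervalIntegrable_of_Icc hσ1 fun u hu ↦ ?_
    exact ((Literature.Analysis.Complex.continuousAt_logDeriv (hg u hu) (h0 u hu)).comp
      (f := fun u : ℝ ↦ (u : ℂ) + t * I) (by fun_prop)).continuousWithinAt
  have hre := intervalIntegral_re hint
  simp only [RCLike.re_to_complex] at hre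
  rw [hre, h]

/-- **`log|ζ(σ₁+it)| − log|ζ(σ+it)| ≤ ∫_σ^{σ₁} F(u+it) du`** under RH for `½ < σ ≤ σ₁ ≤ 2`,
`log t ≥ 8` (BR Prop. 2: `Re ζ'/ζ ≤ F − ½ log t + 4 ≤ F`). [cite: BalazardDeRoton2008, Prop. 8 (proof), (t58)] -/
theorem log_norm_zeta_sub_le_integral (hRH : RiemannHypothesis) {σ σ₁ t : ℝ} (hσ : 1 / 2 < σ) (hσ1 : σ ≤ σ₁)
    (hσ2 : σ₁ ≤ 2) (ht : 8 ≤ Real.log t) (ht2 : 2 ≤ t) :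
    Real.log ‖riemannZeta ((σ₁ : ℂ) + t * I)‖ - Real.log ‖riemannZeta ((σ : ℂ) + t * I)‖ ≤
      ∫ u in σ..σ₁, reZeroSideSum ((u : ℂ) + t * I) := by
  have ht0 : t ≠ 0 := by intro h; rw [h] at ht2; linarith
  rw [← integral_re_logDeriv_zeta' hRH hσ hσ1 ht0]
  have hg : ∀ u ∈ Icc σ σ₁, AnalyticAt ℂ riemannZeta ((u : ℂ) + t * I) := fun u _ ↦ analyticAt_zeta_line ht0
  have h0 : ∀ u ∈ Icc σ σ₁, riemannZeta ((u : ℂ) + t * I) ≠ 0 := fun u hu ↦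
    zeta_line_ne_zero hRH (by linarith [hu.1]) ht0
  have hi1 : IntervalIntegrable (fun u : ℝ ↦ (deriv riemannZeta ((u : ℂ) + t * I) / riemannZeta ((u : ℂ) + t * I)).re)
      volume σ σ₁ := by
    refine ContinuousOn.intervalIntegrable_of_Icc hσ1 fun u hu ↦ ?_
    exact (Complex.continuous_re.continuousAt.comp ((Literature.Analysis.Complex.continuousAt_logDeriv (hg u hu)
      (h0 u hu)).comp (f := fun u : ℝ ↦ (u : ℂ) + t * I) (by fun_prop))).continuousWithinAt
  have hi2 : IntervalIntegrable (fun u : ℝ ↦ reZeroSideSum ((u : ℂ) + t * I)) volume σ σ₁ :=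
    ((continuousOn_reZeroSideSum hRH hσ t).mono (Icc_subset_Icc_right hσ2)).intervalIntegrable_of_Icc hσ1
  refine intervalIntegral.integral_mono_on hσ1 hi1 hi2 fun u hu ↦ ?_
  have h2 := abs_re_logDeriv_zeta_sub_reZeroSideSum_le (s := (u : ℂ) + t * I) (by simp; linarith [hu.1])
    (by simp; linarith [hu.2]) (by simpa using ht2) (zeta_line_ne_zero hRH (by linarith [hu.1]) ht0)
  have h3 := (abs_le.1 h2).2
  simp only [Complex.add_im, Complex.ofReal_im, Complex.mul_im, Complex.ofReal_re, Complex.I_im, mul_one,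
    Complex.I_re, mul_zero, add_zero, zero_add] at h3
  linarith

/-- **`∫_σ^{σ₁} F(u+it) du = Σ_ρ m(ρ)(log‖(σ₁+it)−ρ‖ − log‖(σ+it)−ρ‖)`** (RH, `½ < σ ≤ σ₁ ≤ 2`). [cite: BalazardDeRoton2008, (t58)] -/
theorem integral_reZeroSideSum' (hRH : RiemannHypothesis) {σ σ₁ : ℝ} (hσ : 1 / 2 < σ) (hσ1 : σ ≤ σ₁)
    (hσ2 : σ₁ ≤ 2) (t : ℝ) :
    ∫ u in σ..σ₁, reZeroSideSum ((u : ℂ) + t * I) =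
      ∑' ρ : 𝒵, (riemannZetaZeroOrder (ρ : ℂ) : ℝ) *
        (Real.log ‖((σ₁ : ℂ) + t * I) - ρ‖ - Real.log ‖((σ : ℂ) + t * I) - ρ‖) := by
  have hσ1' : 1 / 2 < σ₁ := by linarith
  have h1 := integral_reZeroSideSum hRH hσ (hσ1.trans hσ2) t
  have h2 := integral_reZeroSideSum hRH hσ1' hσ2 t
  have hi : ∀ a b : ℝ, 1 / 2 < a → a ≤ b → b ≤ 2 → IntervalIntegrable (fun u : ℝ ↦ reZeroSideSum ((u : ℂ) + t * I)) volume a b :=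
    fun a b ha hab hb ↦ ((continuousOn_reZeroSideSum hRH ha t).mono (Icc_subset_Icc_right hb)).intervalIntegrable_of_Icc hab
  have hsplit := intervalIntegral.integral_add_adjacent_intervals (hi σ σ₁ hσ hσ1 hσ2) (hi σ₁ 2 hσ1' hσ2 le_rfl)
  have hs1 := summable_zeroOrder_mul_log_norm_sub hRH hσ (hσ1.trans hσ2) t
  have hs2 := summable_zeroOrder_mul_log_norm_sub hRH hσ1' hσ2 t
  have e : (∫ u in σ..σ₁, reZeroSideSum ((u : ℂ) + t * I)) =
      (∫ u in σ..2, reZeroSideSum ((u : ℂ) + t * I)) - ∫ u in σ₁..2, reZeroSideSum ((u : ℂ) + t * I) := by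
    linarith
  rw [e, h1, h2, ← hs1.tsum_sub hs2]
  refine tsum_congr fun ρ ↦ ?_
  ring

/-! ### Windows with a centre and an offset -/

/-- **Centre + shells** (BR, proof of Prop. 8): with a centre `]t−η, t+η]` carrying at most `B₀`
zeros and `K` shells of width `h` on each side (every window `]u,u+h]` inside carrying at most `B`
zeros), a non-negative weight with `w ≤ W_c` everywhere and `w(γ) ≤ W_j` for `|t−γ| ≥ η + jh`:
`Σ_{t−η−Kh < γ ≤ t+η+Kh} m(ρ) w(γ) ≤ W_c B₀ + 2B Σ_{j<K} W_j`. [cite: BalazardDeRoton2008, Prop. 8 (proof)] -/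
theorem sum_windows_offset_le {t h η : ℝ} (hh : 0 < h) (hη : 0 ≤ η) {w : ℝ → ℝ} {Wc : ℝ} (hWc0 : 0 ≤ Wc)
    (hwc : ∀ y, w y ≤ Wc) {Wj : ℕ → ℝ} (hWj0 : ∀ j, 0 ≤ Wj j)
    (hW : ∀ (j : ℕ) (y : ℝ), η + (j : ℝ) * h ≤ |t - y| → w y ≤ Wj j) {B₀ B : ℝ}
    (hB₀ : (zetaZeroCount (t + η) : ℝ) - zetaZeroCount (t - η) ≤ B₀) :
    ∀ K : ℕ, 0 ≤ t - η - K * h →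
      (∀ u : ℝ, t - η - K * h ≤ u → u + h ≤ t + η + K * h → (zetaZeroCount (u + h) : ℝ) - zetaZeroCount u ≤ B) →
      ∑ ρ ∈ zerosBetween (t - η - K * h) (t + η + K * h), (riemannZetaZeroOrder ρ : ℝ) * w ρ.im ≤
        Wc * B₀ + 2 * B * ∑ j ∈ Finset.range K, Wj j := by
  intro K
  induction K with
  | zero =>
    intro h0 _
    simp only [Nat.cast_zero, zero_mul, sub_zero, add_zero, Finset.range_zero, Finset.sum_empty, mul_zero] at h0 ⊢
    exact (sum_zerosBetween_le_count h0 (by linarith : t - η ≤ t + η) fun ρ _ ↦ hwc ρ.im).trans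
      (mul_le_mul_of_nonneg_left hB₀ hWc0)
  | succ K ih =>
    intro h0 hB
    push_cast at h0 hB ⊢
    have h0' : 0 ≤ t - η - K * h := by nlinarith
    have hKh : 0 ≤ (K : ℝ) * h := by positivity
    have e1 : t - η - (K + 1) * h ≤ t - η - K * h := by nlinarith
    have e2 : t - η - K * h ≤ t + η + K * h := by linarith
    have e3 : t + η + K * h ≤ t + η + (K + 1) * h := by nlinarith
    rw [sum_zerosBetween_split h0 e1 (e2.trans e3), sum_zerosBetween_split h0' e2 e3]
    have hIH := ih h0' (fun u hu1 hu2 ↦ hB u (by linarith) (by linarith))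
    have hleft : ∑ ρ ∈ zerosBetween (t - η - (K + 1) * h) (t - η - K * h), (riemannZetaZeroOrder ρ : ℝ) * w ρ.im ≤
        Wj K * B := by
      refine (sum_zerosBetween_le_count h0 e1 fun ρ hρ ↦ hW K ρ.im ?_).trans ?_
      · rw [mem_zerosBetween h0] at hρ
        rw [abs_of_nonneg (by linarith [hρ.2.2.2.2])]; linarith [hρ.2.2.2.2]
      · refine mul_le_mul_of_nonneg_left ?_ (hWj0 K)
        have := hB (t - η - (K + 1) * h) le_rfl (by nlinarith)
        have e : t - η - (K + 1) * h + h = t - η - K * h := by ring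
        rwa [e] at this
    have hright : ∑ ρ ∈ zerosBetween (t + η + K * h) (t + η + (K + 1) * h), (riemannZetaZeroOrder ρ : ℝ) * w ρ.im ≤
        Wj K * B := by
      refine (sum_zerosBetween_le_count (by linarith) e3 fun ρ hρ ↦ hW K ρ.im ?_).trans ?_
      · rw [mem_zerosBetween (by linarith)] at hρ
        rw [abs_of_nonpos (by linarith [hρ.2.2.2.1])]; linarith [hρ.2.2.2.1]
      · refine mul_le_mul_of_nonneg_left ?_ (hWj0 K)
        have := hB (t + η + K * h) (by linarith) (by nlinarith)
        have e : t + η + K * h + h = t + η + (K + 1) * h := by ring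
        rwa [e] at this
    rw [Finset.sum_range_succ]
    nlinarith [hleft, hright, hIH, hWj0 K]

/-- **Centre + shells + tail** for the full sum over the zeros. [cite: BalazardDeRoton2008, Prop. 8 (proof)] -/
theorem tsum_zeroOrder_mul_le_center_windows_tail {t h η : ℝ} (hh : 0 < h) (hη : 0 ≤ η) {w : ℝ → ℝ}
    {Wc : ℝ} (hWc0 : 0 ≤ Wc) (hwc : ∀ y, w y ≤ Wc) {Wj : ℕ → ℝ} (hWj0 : ∀ j, 0 ≤ Wj j)
    (hW : ∀ (j : ℕ) (y : ℝ), η + (j : ℝ) * h ≤ |t - y| → w y ≤ Wj j) {B₀ B : ℝ}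
    (hB₀ : (zetaZeroCount (t + η) : ℝ) - zetaZeroCount (t - η) ≤ B₀) {K : ℕ} (hK : 0 ≤ t - η - K * h)
    (hB : ∀ u : ℝ, t - η - K * h ≤ u → u + h ≤ t + η + K * h → (zetaZeroCount (u + h) : ℝ) - zetaZeroCount u ≤ B)
    {C₀ : ℝ} (hC₀ : 0 ≤ C₀) (htail : ∀ y : ℝ, η + (K : ℝ) * h ≤ |t - y| → w y ≤ C₀ / (1 + (t - y) ^ 2))
    (hsum : Summable fun ρ : 𝒵 ↦ (riemannZetaZeroOrder (ρ : ℂ) : ℝ) * w (ρ : ℂ).im) :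
    ∑' ρ : 𝒵, (riemannZetaZeroOrder (ρ : ℂ) : ℝ) * w (ρ : ℂ).im ≤
      Wc * B₀ + 2 * B * ∑ j ∈ Finset.range K, Wj j +
        C₀ * ∑' ρ : 𝒵, (riemannZetaZeroOrder (ρ : ℂ) : ℝ) / (1 + (t - (ρ : ℂ).im) ^ 2) := by
  classical
  set S : Finset 𝒵 := (zerosBetween (t - η - K * h) (t + η + K * h)).subtype (· ∈ 𝒵) with hS
  set f : 𝒵 → ℝ := fun ρ ↦ (riemannZetaZeroOrder (ρ : ℂ) : ℝ) * w (ρ : ℂ).im with hf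
  rw [← hsum.sum_add_tsum_subtype_compl S]
  have hfin : ∑ ρ ∈ S, f ρ = ∑ ρ ∈ zerosBetween (t - η - K * h) (t + η + K * h), (riemannZetaZeroOrder ρ : ℝ) * w ρ.im := by
    have h1 := Finset.sum_subtype_eq_sum_filter (s := zerosBetween (t - η - K * h) (t + η + K * h)) (p := (· ∈ 𝒵))
      (fun z : ℂ ↦ (riemannZetaZeroOrder z : ℝ) * w z.im)
    rw [Finset.filter_true_of_mem (fun ρ hρ ↦
      (show ρ ∈ ZetaZeros.riemannZetaNontrivialZeros from mem_nontrivialZeros_of_mem_zerosBetween hK hρ))] at h1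
    exact h1
  have hwin := sum_windows_offset_le hh hη hWc0 hwc hWj0 hW hB₀ K hK hB
  have hdens : Summable fun ρ : 𝒵 ↦ (riemannZetaZeroOrder (ρ : ℂ) : ℝ) / (1 + (t - (ρ : ℂ).im) ^ 2) := by
    have hS' := (ZetaZeroSum.summable_zeroOrder_div_one_add_sq).mul_left (2 * (1 + t ^ 2))
    refine Summable.of_nonneg_of_le (fun ρ ↦ div_nonneg (zeroOrder_nonneg ρ) (by positivity)) (fun ρ ↦ ?_) hS'
    have h1 := OrdinateDictionary.one_div_one_add_sq_sub_le t (ρ : ℂ).im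
    have hm := zeroOrder_nonneg ρ
    calc (riemannZetaZeroOrder (ρ : ℂ) : ℝ) / (1 + (t - (ρ : ℂ).im) ^ 2)
        = (riemannZetaZeroOrder (ρ : ℂ) : ℝ) * (1 / (1 + (t - (ρ : ℂ).im) ^ 2)) := by ring
      _ ≤ (riemannZetaZeroOrder (ρ : ℂ) : ℝ) * (2 * (1 + t ^ 2) / (1 + (ρ : ℂ).im ^ 2)) :=
          mul_le_mul_of_nonneg_left h1 hm
      _ = 2 * (1 + t ^ 2) * ((riemannZetaZeroOrder (ρ : ℂ) : ℝ) / (1 + (ρ : ℂ).im ^ 2)) := by ring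
  have htail_le : ∑' ρ : {ρ : 𝒵 // ρ ∉ S}, f ρ ≤
      C₀ * ∑' ρ : 𝒵, (riemannZetaZeroOrder (ρ : ℂ) : ℝ) / (1 + (t - (ρ : ℂ).im) ^ 2) := by
    have hpt : ∀ ρ : {ρ : 𝒵 // ρ ∉ S}, f ρ ≤ C₀ * ((riemannZetaZeroOrder ((ρ : 𝒵) : ℂ) : ℝ) /
        (1 + (t - ((ρ : 𝒵) : ℂ).im) ^ 2)) := by
      intro ρ
      have hnot : ((ρ : 𝒵) : ℂ) ∉ zerosBetween (t - η - K * h) (t + η + K * h) := fun hmem ↦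
        ρ.2 (Finset.mem_subtype.2 hmem)
      have hz := ZetaZeros.riemannZetaNontrivialZeros.zeta_eq_zero (ρ : 𝒵).2
      have hre0 := ZetaZeros.riemannZetaNontrivialZeros.re_pos (ρ : 𝒵).2
      have hre1 := ZetaZeros.riemannZetaNontrivialZeros.re_lt_one (ρ : 𝒵).2
      have hfar : η + (K : ℝ) * h ≤ |t - ((ρ : 𝒵) : ℂ).im| := by
        by_contra hlt
        rw [not_le, abs_lt] at hlt
        exact hnot ((mem_zerosBetween hK).2 ⟨hz, hre0.le, hre1.le, by linarith [hlt.2], by linarith [hlt.1]⟩)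
      have := mul_le_mul_of_nonneg_left (htail _ hfar) (zeroOrder_nonneg (ρ : 𝒵))
      simp only [hf]
      calc (riemannZetaZeroOrder ((ρ : 𝒵) : ℂ) : ℝ) * w ((ρ : 𝒵) : ℂ).im
          ≤ (riemannZetaZeroOrder ((ρ : 𝒵) : ℂ) : ℝ) * (C₀ / (1 + (t - ((ρ : 𝒵) : ℂ).im) ^ 2)) := this
        _ = _ := by ring
    have hsub : Summable fun ρ : {ρ : 𝒵 // ρ ∉ S} ↦ C₀ * ((riemannZetaZeroOrder ((ρ : 𝒵) : ℂ) : ℝ) /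
        (1 + (t - ((ρ : 𝒵) : ℂ).im) ^ 2)) := (hdens.mul_left C₀).subtype _
    calc ∑' ρ : {ρ : 𝒵 // ρ ∉ S}, f ρ
        ≤ ∑' ρ : {ρ : 𝒵 // ρ ∉ S}, C₀ * ((riemannZetaZeroOrder ((ρ : 𝒵) : ℂ) : ℝ) / (1 + (t - ((ρ : 𝒵) : ℂ).im) ^ 2)) :=
          (hsum.subtype _).tsum_le_tsum hpt hsub
      _ ≤ ∑' ρ : 𝒵, C₀ * ((riemannZetaZeroOrder (ρ : ℂ) : ℝ) / (1 + (t - (ρ : ℂ).im) ^ 2)) :=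
          Summable.tsum_subtype_le _ _ (fun ρ ↦ mul_nonneg hC₀ (div_nonneg (zeroOrder_nonneg ρ) (by positivity)))
            (hdens.mul_left C₀)
      _ = C₀ * ∑' ρ : 𝒵, (riemannZetaZeroOrder (ρ : ℂ) : ℝ) / (1 + (t - (ρ : ℂ).im) ^ 2) := tsum_mul_left
  rw [hfin]
  linarith

/-! ### The weight `w(γ) = ½(log(a₀² + (γ−t)²) − log(a² + (γ−t)²))` of Prop. 8 -/

section Weight

variable {a a₀ t : ℝ}

/-- The weight of (t58): `w(y) = ½(log(a₀² + (y−t)²) − log(a² + (y−t)²))`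
(`= log‖(σ₀+it) − ρ‖ − log‖(σ+it) − ρ‖` for `ρ = ½ + iy`, `a = σ − ½`, `a₀ = σ₀ − ½`). [cite: BalazardDeRoton2008, Prop. 8 (proof), (t58)] -/
def wgt (a a₀ t : ℝ) (y : ℝ) : ℝ := (Real.log (a₀ ^ 2 + (y - t) ^ 2) - Real.log (a ^ 2 + (y - t) ^ 2)) / 2

/-- `w ≥ 0` for `a ≤ a₀`. [folklore] -/
theorem wgt_nonneg (ha : 0 < a) (haa : a ≤ a₀) (y : ℝ) : 0 ≤ wgt a a₀ t y := by
  unfold wgt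
  have : Real.log (a ^ 2 + (y - t) ^ 2) ≤ Real.log (a₀ ^ 2 + (y - t) ^ 2) :=
    Real.log_le_log (by positivity) (by nlinarith)
  linarith

/-- `w ≤ log(a₀/a)` (the ratio `(a₀²+D)/(a²+D)` decreases in `D ≥ 0`). [folklore] -/
theorem wgt_le_log (ha : 0 < a) (haa : a ≤ a₀) (y : ℝ) : wgt a a₀ t y ≤ Real.log (a₀ / a) := by
  unfold wgt
  have ha0 : 0 < a₀ := by linarith
  set D : ℝ := (y - t) ^ 2 with hD
  have hD0 : 0 ≤ D := by positivity
  have h1 : Real.log (a₀ ^ 2 + D) - Real.log (a ^ 2 + D) = Real.log ((a₀ ^ 2 + D) / (a ^ 2 + D)) := by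
    rw [Real.log_div (by positivity) (by positivity)]
  have h2 : (a₀ ^ 2 + D) / (a ^ 2 + D) ≤ (a₀ / a) ^ 2 := by
    rw [div_pow, div_le_div_iff₀ (by positivity) (by positivity)]
    nlinarith [mul_le_mul_of_nonneg_right (pow_le_pow_left₀ ha.le haa 2) hD0]
  have h3 : Real.log ((a₀ ^ 2 + D) / (a ^ 2 + D)) ≤ Real.log ((a₀ / a) ^ 2) :=
    Real.log_le_log (by positivity) h2
  rw [Real.log_pow] at h3
  push_cast at h3
  linarith

/-- On the shell `|t − y| ≥ r > 0`: `w ≤ ½ log(1 + a₀²/r²)`. [folklore] -/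
theorem wgt_le_shell {r y : ℝ} (hr : 0 < r) (hd : r ≤ |t - y|) :
    wgt a a₀ t y ≤ Real.log (1 + a₀ ^ 2 / r ^ 2) / 2 := by
  unfold wgt
  set D : ℝ := (y - t) ^ 2 with hD
  have hrD : r ^ 2 ≤ D := by
    rw [hD, ← sq_abs (y - t), abs_sub_comm]; exact pow_le_pow_left₀ hr.le hd 2
  have hD0 : 0 < D := lt_of_lt_of_le (by positivity) hrD
  have h1 : Real.log (a₀ ^ 2 + D) - Real.log (a ^ 2 + D) ≤ Real.log (a₀ ^ 2 + D) - Real.log D := by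
    have : Real.log D ≤ Real.log (a ^ 2 + D) := Real.log_le_log hD0 (by nlinarith)
    linarith
  have h2 : Real.log (a₀ ^ 2 + D) - Real.log D = Real.log (1 + a₀ ^ 2 / D) := by
    rw [← Real.log_div (by positivity) hD0.ne']
    congr 1; field_simp; ring
  have h3 : Real.log (1 + a₀ ^ 2 / D) ≤ Real.log (1 + a₀ ^ 2 / r ^ 2) := by
    refine Real.log_le_log (by positivity) ?_
    have : a₀ ^ 2 / D ≤ a₀ ^ 2 / r ^ 2 := div_le_div_of_nonneg_left (by positivity) (by positivity) hrD
    linarith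
  linarith

/-- On the tail `|t − y| ≥ ¼`: `w ≤ 9a₀²/(1 + (t−y)²)`. [folklore] -/
theorem wgt_le_tail (ha : 0 < a) {y : ℝ} (hd : 1 / 4 ≤ |t - y|) :
    wgt a a₀ t y ≤ 9 * a₀ ^ 2 / (1 + (t - y) ^ 2) := by
  unfold wgt
  set D : ℝ := (y - t) ^ 2 with hD
  have hD16 : 1 / 16 ≤ D := by
    rw [hD, ← sq_abs (y - t), abs_sub_comm]; nlinarith [abs_nonneg (t - y)]
  have hD0 : 0 < D := by linarith
  have e : (t - y) ^ 2 = D := by rw [hD]; ring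
  rw [e]
  have h1 : Real.log (a₀ ^ 2 + D) - Real.log (a ^ 2 + D) ≤ a₀ ^ 2 / D := by
    rw [← Real.log_div (by positivity) (by positivity)]
    refine (Real.log_le_sub_one_of_pos (by positivity)).trans ?_
    rw [div_sub_one (by positivity), div_le_div_iff₀ (by positivity) hD0]
    nlinarith [sq_nonneg a, mul_nonneg (sq_nonneg a) (sq_nonneg a₀)]
  have h2 : a₀ ^ 2 / D ≤ 17 * a₀ ^ 2 / (1 + D) := by
    rw [div_le_div_iff₀ hD0 (by positivity)]; nlinarith [sq_nonneg a₀]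
  have h3 : 0 ≤ a₀ ^ 2 / (1 + D) := by positivity
  have e2 : 17 * a₀ ^ 2 / (1 + D) = 17 * (a₀ ^ 2 / (1 + D)) := by ring
  have e3 : 9 * a₀ ^ 2 / (1 + D) = 9 * (a₀ ^ 2 / (1 + D)) := by ring
  rw [e3]; rw [e2] at h2
  linarith

/-- The shell weights summed: `Σ_{j<K} ½ log(1 + a₀²/(η+jh)²) ≤ ½ log(1 + (a₀/η)²) + (a₀/h)²`. [folklore] -/
theorem sum_shell_weights_le {η h : ℝ} (hη : 0 < η) (hh : 0 < h) (a₀ : ℝ) (K : ℕ) :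
    ∑ j ∈ Finset.range K, Real.log (1 + a₀ ^ 2 / (η + (j : ℝ) * h) ^ 2) / 2 ≤
      Real.log (1 + (a₀ / η) ^ 2) / 2 + (a₀ / h) ^ 2 := by
  rcases Nat.eq_zero_or_pos K with hK | hK
  · subst hK
    simp only [Finset.range_zero, Finset.sum_empty]
    have : 0 ≤ Real.log (1 + (a₀ / η) ^ 2) := Real.log_nonneg (by nlinarith [sq_nonneg (a₀ / η)])
    positivity
  rw [Finset.range_eq_Ico, Finset.sum_eq_sum_Ico_succ_bot hK]
  simp only [Nat.cast_zero, zero_mul, add_zero]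
  have e0 : a₀ ^ 2 / η ^ 2 = (a₀ / η) ^ 2 := by rw [div_pow]
  rw [e0]
  have hrest : ∑ j ∈ Finset.Ico 1 K, Real.log (1 + a₀ ^ 2 / (η + (j : ℝ) * h) ^ 2) / 2 ≤ (a₀ / h) ^ 2 := by
    have hterm : ∀ j ∈ Finset.Ico 1 K, Real.log (1 + a₀ ^ 2 / (η + (j : ℝ) * h) ^ 2) / 2 ≤
        (a₀ / h) ^ 2 / 2 * ((j : ℝ) ^ 2)⁻¹ := by
      intro j hj
      rw [Finset.mem_Ico] at hj
      have hj1 : (1 : ℝ) ≤ j := by exact_mod_cast hj.1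
      have hjh : 0 < (j : ℝ) * h := by positivity
      have h1 : Real.log (1 + a₀ ^ 2 / (η + (j : ℝ) * h) ^ 2) ≤ a₀ ^ 2 / (η + (j : ℝ) * h) ^ 2 := by
        have := Real.log_le_sub_one_of_pos (show 0 < 1 + a₀ ^ 2 / (η + (j : ℝ) * h) ^ 2 by positivity)
        linarith
      have h2 : a₀ ^ 2 / (η + (j : ℝ) * h) ^ 2 ≤ a₀ ^ 2 / ((j : ℝ) * h) ^ 2 :=
        div_le_div_of_nonneg_left (by positivity) (by positivity) (by nlinarith)
      have e : a₀ ^ 2 / ((j : ℝ) * h) ^ 2 = (a₀ / h) ^ 2 * ((j : ℝ) ^ 2)⁻¹ := by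
        field_simp
      rw [e] at h2
      linarith
    refine (Finset.sum_le_sum hterm).trans ?_
    rw [← Finset.mul_sum]
    have hs : ∑ j ∈ Finset.Ico 1 K, ((j : ℝ) ^ 2)⁻¹ ≤ 2 := by
      have h := sum_Ioo_inv_sq_le (α := ℝ) 0 K
      have e : Finset.Ioo 0 K = Finset.Ico 1 K := by ext n; simp [Finset.mem_Ioo, Finset.mem_Ico]; omega
      rw [e] at h; norm_num at h; exact_mod_cast h
    have h0 : 0 ≤ (a₀ / h) ^ 2 / 2 := by positivity
    nlinarith [hs, h0]
  linarith

end Weight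

/-! ### Prop. 8: the integral `∫_σ^{σ₀} F(u+it) du` at a typical ordinate -/

/-- Numerical facts for `T ≥ exp(exp 33)` and `(log log T)² ≤ V ≤ log T/log log T`. [folklore] -/
theorem sizes_of_large {T V : ℝ} (hT : Real.exp (Real.exp 33) ≤ T) (hVl : Real.log (Real.log T) ^ 2 ≤ V)
    (hVu : V ≤ Real.log T / Real.log (Real.log T)) :
    0 < T ∧ 34 ≤ Real.log T ∧ 33 ≤ Real.log (Real.log T) ∧ 1089 ≤ V ∧ 33 * V ≤ Real.log T ∧
      4 ≤ Real.log V ∧ 0 ≤ Real.log (Real.log V) := by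
  have hee : 0 < Real.exp (Real.exp 33) := Real.exp_pos _
  have hT0 : 0 < T := hee.trans_le hT
  have hL1 : Real.exp 33 ≤ Real.log T := by
    rw [← Real.log_exp (Real.exp 33)]; exact Real.log_le_log hee hT
  have h34 : (34 : ℝ) ≤ Real.exp 33 := by have := Real.add_one_le_exp (33 : ℝ); linarith
  have hlogT : 34 ≤ Real.log T := h34.trans hL1
  have hL2 : 33 ≤ Real.log (Real.log T) := by
    rw [← Real.log_exp 33]; exact Real.log_le_log (Real.exp_pos _) hL1
  have hL20 : 0 < Real.log (Real.log T) := by linarith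
  have hV : 1089 ≤ V := le_trans (by nlinarith) hVl
  have h33V : 33 * V ≤ Real.log T := by
    have := (le_div_iff₀ hL20).1 hVu
    nlinarith
  -- `log V ≥ 4`: `exp 4 ≤ 1089`
  have he : Real.exp 1 < 2.7182818286 := Real.exp_one_lt_d9
  have he0 : 0 < Real.exp 1 := Real.exp_pos 1
  have he4 : Real.exp 4 ≤ 1089 := by
    have : Real.exp 4 = Real.exp 1 ^ 4 := by rw [← Real.exp_nat_mul]; norm_num
    rw [this]
    nlinarith [pow_le_pow_left₀ he0.le he.le 4]
  have hlogV : 4 ≤ Real.log V := by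
    rw [← Real.log_exp 4]; exact Real.log_le_log (Real.exp_pos 4) (he4.trans hV)
  have hllV : 0 ≤ Real.log (Real.log V) := Real.log_nonneg (by linarith)
  exact ⟨hT0, hlogT, hL2, hV, h33V, hlogV, hllV⟩

set_option maxHeartbeats 1600000 in
/-- **The zero sum of (t58) at a typical ordinate** (RH; BR Prop. 8, proof): for `T ≥ exp(exp 33)`,
`(log log T)² ≤ V ≤ log T/log log T`, `0 < δ ≤ 1`, `t` typical, `½ < σ ≤ σ₀ = ½ + V/log T`,
`∫_σ^{σ₀} F(u+it) du ≤ V log((V/log T)/(σ−½)) + 2(1+δ)V log log V + (1 + 18A) V δ⁻²`,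
`A` the local-density constant. [cite: BalazardDeRoton2008, Prop. 8] -/
theorem integral_F_le_of_isTypical (hRH : RiemannHypothesis) {A : ℝ} (hA0 : 0 < A)
    (hA : ∀ t : ℝ, ∑' ρ : 𝒵, (riemannZetaZeroOrder (ρ : ℂ) : ℝ) / (1 + (t - (ρ : ℂ).im) ^ 2) ≤ A * Real.log (|t| + 2))
    {T V δ t σ : ℝ} (hT : Real.exp (Real.exp 33) ≤ T) (hVl : Real.log (Real.log T) ^ 2 ≤ V)
    (hVu : V ≤ Real.log T / Real.log (Real.log T)) (hδ0 : 0 < δ) (hδ1 : δ ≤ 1) (ht : IsTypical δ T V t)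
    (hσ : 1 / 2 < σ) (hσ0 : σ ≤ 1 / 2 + V / Real.log T) :
    ∫ u in σ..(1 / 2 + V / Real.log T), reZeroSideSum ((u : ℂ) + t * I) ≤
      V * Real.log ((V / Real.log T) / (σ - 1 / 2)) + 2 * (1 + δ) * V * Real.log (Real.log V) +
        (1 + 18 * A) * V * δ⁻¹ ^ 2 := by
  obtain ⟨hT0, hlogT, hL2, hV, h33V, hlogV, hllV⟩ := sizes_of_large hT hVl hVu
  obtain ⟨hTt, ht2T⟩ := ht.size
  have hlogT0 : 0 < Real.log T := by linarith
  have hV0 : 0 < V := by linarith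
  have hlogV0 : 0 < Real.log V := by linarith
  have hπ3 := Real.pi_gt_three
  have hπ4 := Real.pi_lt_four
  -- parameters
  set a₀ : ℝ := V / Real.log T with ha₀
  set a : ℝ := σ - 1 / 2 with ha
  have ha0 : 0 < a := by rw [ha]; linarith
  have haa : a ≤ a₀ := by rw [ha, ha₀]; linarith
  have ha₀0 : 0 < a₀ := by positivity
  have ha₀le : a₀ ≤ 1 / 33 := by
    rw [ha₀, div_le_iff₀ hlogT0]; linarith
  have hσ0' : 1 / 2 < 1 / 2 + V / Real.log T := by linarith [ha₀0]
  have hσ02 : 1 / 2 + V / Real.log T ≤ 2 := by rw [← ha₀]; linarith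
  set h : ℝ := 2 * π * δ * V / Real.log T with hh
  have hh0 : 0 < h := by positivity
  have hhle : h ≤ 1 / 4 := by
    rw [hh, div_le_iff₀ hlogT0]
    have hpd : π * δ ≤ 4 := by nlinarith
    have := mul_le_mul_of_nonneg_right hpd (by linarith : (0 : ℝ) ≤ V)
    nlinarith
  set η : ℝ := Real.pi * V / (Real.log V * Real.log T) with hη
  have hη0 : 0 < η := by positivity
  have hηle : η ≤ 1 / 8 := by
    rw [hη, div_le_iff₀ (by positivity)]
    have : π * V ≤ 4 * V := by nlinarith
    nlinarith [mul_le_mul_of_nonneg_left h33V hlogV0.le]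
  -- the number of shells: `¼ ≤ Kh ≤ ½`
  obtain ⟨K, hK1, hK2⟩ := exists_window_number (h := 2 * h) (by positivity) (by linarith)
  have hKh1 : 1 / 4 ≤ (K : ℝ) * h := by linarith
  have hKh2 : (K : ℝ) * h ≤ 1 / 2 := by linarith
  have hT1 : 1 ≤ T := by
    have := Real.add_one_le_exp (Real.exp 33); linarith [Real.exp_pos (33 : ℝ)]
  have hKt : 0 ≤ t - η - K * h := by linarith
  -- the weight and the sum
  set w : ℝ → ℝ := wgt a a₀ t with hw
  have hs1 := summable_zeroOrder_mul_log_norm_sub hRH hσ (hσ0.trans hσ02) t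
  have hs2 := summable_zeroOrder_mul_log_norm_sub hRH hσ0' hσ02 t
  have hlogn : ∀ (u : ℝ) (ρ : 𝒵), Real.log ‖((u : ℂ) + t * I) - ρ‖ = Real.log ((u - 1 / 2) ^ 2 + ((ρ : ℂ).im - t) ^ 2) / 2 := by
    intro u ρ
    have h1 : Real.log ‖((u : ℂ) + t * I) - ρ‖ = Real.log (‖((u : ℂ) + t * I) - ρ‖ ^ 2) / 2 := by
      rw [Real.log_pow]; push_cast; ring
    rw [h1, norm_sq_sub_zero_of_RH hRH]
  have hterm : ∀ ρ : 𝒵, (riemannZetaZeroOrder (ρ : ℂ) : ℝ) *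
      (Real.log ‖(((1 / 2 + V / Real.log T : ℝ) : ℂ) + t * I) - ρ‖ - Real.log ‖((σ : ℂ) + t * I) - ρ‖) =
      (riemannZetaZeroOrder (ρ : ℂ) : ℝ) * w (ρ : ℂ).im := by
    intro ρ
    rw [hlogn, hlogn, hw, wgt]
    have e1 : (1 / 2 + V / Real.log T - 1 / 2) = a₀ := by rw [ha₀]; ring
    rw [e1, show σ - 1 / 2 = a from rfl]
    ring
  have hI : (∫ u in σ..(1 / 2 + V / Real.log T), reZeroSideSum ((u : ℂ) + t * I)) =
      ∑' ρ : 𝒵, (riemannZetaZeroOrder (ρ : ℂ) : ℝ) * w (ρ : ℂ).im := by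
    rw [integral_reZeroSideSum' hRH hσ hσ0 hσ02 t]
    exact tsum_congr hterm
  have hsum : Summable fun ρ : 𝒵 ↦ (riemannZetaZeroOrder (ρ : ℂ) : ℝ) * w (ρ : ℂ).im := by
    have := (hs1.sub hs2)
    refine this.congr fun ρ ↦ ?_
    rw [← hterm ρ]
    push_cast
    ring
  -- hypotheses of the window lemma
  have hWc0 : 0 ≤ Real.log (a₀ / a) := Real.log_nonneg ((one_le_div ha0).2 haa)
  have hwc : ∀ y, w y ≤ Real.log (a₀ / a) := fun y ↦ wgt_le_log ha0 haa y
  set Wj : ℕ → ℝ := fun j ↦ Real.log (1 + a₀ ^ 2 / (η + (j : ℝ) * h) ^ 2) / 2 with hWj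
  have hWj0 : ∀ j, 0 ≤ Wj j := fun j ↦ by
    simp only [hWj]
    have : 0 ≤ Real.log (1 + a₀ ^ 2 / (η + (j : ℝ) * h) ^ 2) := Real.log_nonneg (by
      have : 0 ≤ a₀ ^ 2 / (η + (j : ℝ) * h) ^ 2 := by positivity
      linarith)
    linarith
  have hW : ∀ (j : ℕ) (y : ℝ), η + (j : ℝ) * h ≤ |t - y| → w y ≤ Wj j := fun j y hy ↦
    wgt_le_shell (by positivity) hy
  have hB₀ : (zetaZeroCount (t + η) : ℝ) - zetaZeroCount (t - η) ≤ V :=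
    ht.2.2.2.2 t (by linarith) (by linarith)
  have hB : ∀ u : ℝ, t - η - K * h ≤ u → u + h ≤ t + η + K * h →
      (zetaZeroCount (u + h) : ℝ) - zetaZeroCount u ≤ (1 + δ) * V := by
    intro u hu1 hu2
    have h2 := ht.2.2.2.1 (u + Real.pi * δ * V / Real.log T) (by linarith) (by
      have : u + Real.pi * δ * V / Real.log T + Real.pi * δ * V / Real.log T = u + h := by rw [hh]; ring
      rw [this]; linarith)
    have e1 : u + Real.pi * δ * V / Real.log T + Real.pi * δ * V / Real.log T = u + h := by rw [hh]; ring
    have e2 : u + Real.pi * δ * V / Real.log T - Real.pi * δ * V / Real.log T = u := by ring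
    rwa [e1, e2] at h2
  have htail : ∀ y : ℝ, η + (K : ℝ) * h ≤ |t - y| → w y ≤ 9 * a₀ ^ 2 / (1 + (t - y) ^ 2) := fun y hy ↦
    wgt_le_tail ha0 (by linarith)
  have hmain := tsum_zeroOrder_mul_le_center_windows_tail hh0 hη0.le hWc0 hwc hWj0 hW hB₀ hKt hB
    (by positivity : (0 : ℝ) ≤ 9 * a₀ ^ 2) htail hsum
  rw [hI]
  refine hmain.trans ?_
  -- the three terms
  have hshell := sum_shell_weights_le hη0 hh0 a₀ K
  -- `½ log(1 + (a₀/η)²) ≤ log log V`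
  have hW0 : Real.log (1 + (a₀ / η) ^ 2) / 2 ≤ Real.log (Real.log V) := by
    have hX : a₀ / η = Real.log V / π := by
      rw [ha₀, hη]; field_simp
    rw [hX]
    have hX1 : 1 ≤ Real.log V / π := by rw [le_div_iff₀ (by linarith)]; linarith
    have h1 : Real.log (1 + (Real.log V / π) ^ 2) ≤ Real.log (2 * (Real.log V / π) ^ 2) :=
      Real.log_le_log (by positivity) (by nlinarith)
    have h2 : Real.log (2 * (Real.log V / π) ^ 2) = Real.log 2 + 2 * (Real.log (Real.log V) - Real.log π) := by
      rw [Real.log_mul (by norm_num) (by positivity), Real.log_pow, Real.log_div hlogV0.ne' (by linarith)]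
      push_cast; ring
    have hl2 : Real.log 2 ≤ 1 := by have := Real.log_two_lt_d9; linarith
    have hlπ : 1 ≤ Real.log π := by
      rw [← Real.log_exp 1]
      refine Real.log_le_log (Real.exp_pos 1) ?_
      have := Real.exp_one_lt_d9; linarith
    linarith
  have hah : (a₀ / h) ^ 2 ≤ 1 / 36 * δ⁻¹ ^ 2 := by
    have e : a₀ / h = (2 * π * δ)⁻¹ := by
      rw [ha₀, hh]; field_simp
    have e2 : (1 : ℝ) / 36 * δ⁻¹ ^ 2 = 1 / (36 * δ ^ 2) := by field_simp
    rw [e, e2, inv_pow, ← one_div]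
    have h36 : (36 : ℝ) * δ ^ 2 ≤ (2 * π * δ) ^ 2 := by
      have hp : (36 : ℝ) ≤ (2 * π) ^ 2 := by nlinarith
      calc (36 : ℝ) * δ ^ 2 ≤ (2 * π) ^ 2 * δ ^ 2 := by gcongr
        _ = (2 * π * δ) ^ 2 := by ring
    exact one_div_le_one_div_of_le (by positivity : (0 : ℝ) < 36 * δ ^ 2) h36
  have hmid : 2 * ((1 + δ) * V) * ∑ j ∈ Finset.range K, Wj j ≤
      2 * (1 + δ) * V * Real.log (Real.log V) + 1 / 9 * V * δ⁻¹ ^ 2 := by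
    have h1 : ∑ j ∈ Finset.range K, Wj j ≤ Real.log (Real.log V) + 1 / 36 * δ⁻¹ ^ 2 := by
      simp only [hWj]; linarith [hshell, hW0, hah]
    have h2 := mul_le_mul_of_nonneg_left h1 (by positivity : 0 ≤ 2 * ((1 + δ) * V))
    have h3 : 2 * ((1 + δ) * V) * (1 / 36 * δ⁻¹ ^ 2) ≤ 1 / 9 * V * δ⁻¹ ^ 2 := by
      have : (1 + δ) ≤ 2 := by linarith
      have hpos : 0 ≤ V * δ⁻¹ ^ 2 := by positivity
      nlinarith
    nlinarith [h2, h3]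
  have htailb : 9 * a₀ ^ 2 * ∑' ρ : 𝒵, (riemannZetaZeroOrder (ρ : ℂ) : ℝ) / (1 + (t - (ρ : ℂ).im) ^ 2) ≤
      18 * A * V * δ⁻¹ ^ 2 := by
    have hT4 : 4 ≤ T := by
      have := Real.add_one_le_exp (Real.exp 33); have := Real.add_one_le_exp (33 : ℝ); linarith
    have hlogt : Real.log (|t| + 2) ≤ 2 * Real.log T := by
      rw [abs_of_pos (by linarith)]
      have h1 : Real.log (t + 2) ≤ Real.log (T ^ 2) := Real.log_le_log (by linarith) (by nlinarith)
      rw [Real.log_pow] at h1; push_cast at h1; linarith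
    have h1 : ∑' ρ : 𝒵, (riemannZetaZeroOrder (ρ : ℂ) : ℝ) / (1 + (t - (ρ : ℂ).im) ^ 2) ≤ 2 * A * Real.log T := by
      have := (hA t).trans (mul_le_mul_of_nonneg_left hlogt hA0.le); linarith
    have hv : a₀ * Real.log T = V := by rw [ha₀]; field_simp
    have h2 : 9 * a₀ ^ 2 * (2 * A * Real.log T) = 18 * A * V * a₀ := by rw [← hv]; ring
    have h3 : a₀ ≤ δ⁻¹ ^ 2 := by
      have : (1 : ℝ) ≤ δ⁻¹ := one_le_inv_iff₀.2 ⟨hδ0, hδ1⟩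
      nlinarith
    calc 9 * a₀ ^ 2 * ∑' ρ : 𝒵, (riemannZetaZeroOrder (ρ : ℂ) : ℝ) / (1 + (t - (ρ : ℂ).im) ^ 2)
        ≤ 9 * a₀ ^ 2 * (2 * A * Real.log T) := mul_le_mul_of_nonneg_left h1 (by positivity)
      _ = 18 * A * V * a₀ := h2
      _ ≤ 18 * A * V * δ⁻¹ ^ 2 := mul_le_mul_of_nonneg_left h3 (by positivity)
  have hVδ : 0 ≤ V * δ⁻¹ ^ 2 := by positivity
  have e : (1 + 18 * A) * V * δ⁻¹ ^ 2 = V * δ⁻¹ ^ 2 + 18 * A * V * δ⁻¹ ^ 2 := by ring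
  rw [e]
  linarith [hmid, htailb, hVδ, hWc0]

/-! ## Prop. 1 in the consumed shape -/

/-- **Balazard–de Roton 2008, Proposition 1, under RH** (Soundararajan 2009, Prop. 5 refined), in
the packaged shape `TypicalPointwise.Prop1With δ D T₀` consumed by the Soundararajan-contour files:
for `0 < δ ≤ 1` there are `D, T₀` with, for `T ≥ T₀`, `(log log T)² ≤ V ≤ log T/log log T` and a
`V`-typical ordinate `t` of size `T`,
`log|ζ(σ+it)| ≥ −V log((V/log T)/(σ−½)) − 2(1+δ)V log log V − D V δ⁻²` (`½ < σ ≤ ½ + V/log T`) and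
`log|ζ(σ+it)| ≥ −D V δ⁻¹` (`½ + V/log T ≤ σ ≤ 2`). [cite: BalazardDeRoton2008, Prop. 1] -/
theorem prop1With_of_RH (hRH : RiemannHypothesis) {δ : ℝ} (hδ0 : 0 < δ) (hδ1 : δ ≤ 1) :
    ∃ D T₀ : ℝ, 0 ≤ D ∧ TypicalPointwise.Prop1With δ D T₀ := by
  obtain ⟨D₇, T₇, hD₇, h7⟩ := BR_prop7 hRH
  obtain ⟨A, hA0, hA⟩ := exists_tsum_zeroOrder_div_one_add_sq_le
  refine ⟨D₇ + 1 + 18 * A, max T₇ (Real.exp (Real.exp 33)), by positivity, fun T hT V hVl hVu t ht σ ↦ ⟨?_, ?_⟩⟩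
  · intro hσ hσ0
    have hTe : Real.exp (Real.exp 33) ≤ T := (le_max_right _ _).trans hT
    have hT7 : T₇ ≤ T := (le_max_left _ _).trans hT
    obtain ⟨hT0, hlogT, hL2, hV, h33V, hlogV, hllV⟩ := sizes_of_large hTe hVl hVu
    obtain ⟨hTt, ht2T⟩ := ht.size
    have hlogT0 : 0 < Real.log T := by linarith
    have ha₀0 : 0 < V / Real.log T := by positivity
    have hσ02 : 1 / 2 + V / Real.log T ≤ 2 := by
      have : V / Real.log T ≤ 1 := by rw [div_le_one hlogT0]; linarith
      linarith
    have ht2 : (2 : ℝ) ≤ t := by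
      have := Real.add_one_le_exp (Real.exp 33); have := Real.add_one_le_exp (33 : ℝ); linarith
    have hlogt : 8 ≤ Real.log t := by
      have : Real.log T ≤ Real.log t := Real.log_le_log hT0 hTt
      linarith
    -- `log|ζ(σ₀+it)| ≥ −D₇ V/δ` and `log|ζ(σ₀)| − log|ζ(σ)| ≤ ∫F ≤ …`
    have h0 := (h7 T hT7 V hVl hVu δ hδ0 hδ1 t ht (1 / 2 + V / Real.log T) le_rfl hσ02)
    have h1 := log_norm_zeta_sub_le_integral hRH hσ hσ0 hσ02 hlogt ht2
    have h2 := integral_F_le_of_isTypical hRH hA0 hA hTe hVl hVu hδ0 hδ1 ht hσ hσ0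
    have hinv : 1 ≤ δ⁻¹ := one_le_inv_iff₀.2 ⟨hδ0, hδ1⟩
    have h3 : D₇ * V * δ⁻¹ ≤ D₇ * V * δ⁻¹ ^ 2 := by
      have : δ⁻¹ ≤ δ⁻¹ ^ 2 := by nlinarith
      exact mul_le_mul_of_nonneg_left this (by positivity)
    have e : (D₇ + 1 + 18 * A) * V * δ⁻¹ ^ 2 = D₇ * V * δ⁻¹ ^ 2 + (1 + 18 * A) * V * δ⁻¹ ^ 2 := by ring
    rw [e]
    linarith [h0, h1, h2, h3]
  · intro hσ1 hσ2
    have hT7 : T₇ ≤ T := (le_max_left _ _).trans hT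
    have h0 := h7 T hT7 V hVl hVu δ hδ0 hδ1 t ht σ hσ1 hσ2
    have hTe : Real.exp (Real.exp 33) ≤ T := (le_max_right _ _).trans hT
    obtain ⟨hT0, hlogT, hL2, hV, h33V, hlogV, hllV⟩ := sizes_of_large hTe hVl hVu
    have hpos : 0 ≤ V * δ⁻¹ := by positivity
    have : D₇ * V * δ⁻¹ ≤ (D₇ + 1 + 18 * A) * V * δ⁻¹ := by nlinarith
    linarith

end SoundTest

end Literature.NumberTheory.LFunctions
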